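import Literature.AlgebraicGeometry.Motives.FrobeniusSemisimpleIffSelfProductStrongTate
import Literature.AlgebraicGeometry.Motives.ZetaFunctionPoleOrderFrobeniusSemisimple
import Literature.LinearAlgebra.KunnethSemisimplicityBaseChange
import HarnessLib

/-!
# Kahn 2020 Th. 6.54 `S^d(X × X) ⟺ SS^i(X) for all i` for the abstract Weil cohomology WITHOUT any
# hypothesis on the characteristic polynomials (Milne 2007 Th. 1.3 in full)

Topic `Literature/AlgebraicGeometry/Motives`; THEOREMS ONLY (no definition, no instance, no named
fact; D-0026).

B. Kahn, *Zeta and L-functions of varieties and motives* (2020) §6.14 (held, p. 132): «**Theorem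
6.54** ([59, th. 6]) We have the equivalence `S^d(X × X, l) ⟺ SS^i(X, l)` for all `i`.»  J. S. Milne,
arXiv:0709.3040 (held, p. 3–4): «Theorem 1.3. Let `X` be a variety over `𝔽` of dimension `d`. If
`S^{2d}(X × X, ℓ)` is true, then every Frobenius map `π` acts semisimply on `H^*(X, ℚ_ℓ)`.  PROOF. If
`a` occurs as an eigenvalue of `π` on `H^r(X, ℚ_ℓ)`, then `1/a` occurs as an eigenvalue of `π` on
`H^{2d−r}(X, ℚ_ℓ(d))` (by Poincaré duality), and
`H^r(X, ℚ_ℓ)_a ⊗ H^{2d−r}(X, ℚ_ℓ(d))_{1/a} ⊂ H^{2d}(X × X, ℚ_ℓ(d))_1` (Künneth formula), from which the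
claim follows.»

The gen-38 file `FrobeniusSemisimpleIffSelfProductStrongTate` proved the direction `⟹` of Th. 6.54
for the tree's abstract `E : GaloisWeilCohomology k K χ` only under the hypothesis that the
characteristic polynomials of Frobenius SPLIT over the coefficient field `K` («TODO(general form):
eigenvalues outside `K` need semisimplicity after extension of scalars of `E` (not available for the
abstract theory)»).  Extension of scalars OF THE LINEAR ALGEBRA suffices: rows g39-#5/#6
(`Literature/LinearAlgebra/KunnethSemisimplicityCriterion`, `…BaseChange`) run Milne's argument over
`K̄` on the base-changed Poincaré pairing / Künneth product / `S` condition and descend semisimplicity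
to `K`.  This file plugs the cohomology of `E` in:

* §1 **TH. 6.54 ⟹ UNCONDITIONALLY** (`isSemisimple_frobAction_of_strongTate_self_product`): if `1` is
  a semisimple eigenvalue of `χ(F)ᵈ F` on `H^{2d}(X × X)` (`Ker ∩ Range = 0`) then `F` is a semisimple
  endomorphism of every `Hⁱ(X)` — the data for the pure theorem are the Poincaré pairing
  `Hⁱ(X) × H^{2d−i}(X) → K` (perfect, `cupPairing_ρ_ρTwist`-invariant), the external cup product
  `pr₁* a ∪ pr₂* b` (injective on `Hⁱ ⊗ H^{2d−i}`, `extTensor_injective`; equivariant,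
  `ρTwist_externalCup_right`) and `S^d(X × X)`.
* §2 **TH. 6.54 AS AN EQUIVALENCE, UNCONDITIONALLY** (`strongTate_self_product_iff_forall_isSemisimple_frobAction`),
  with the corollaries: `S` for every twisted Frobenius on `H^*(X × X)` and on `H^*(X)`, `SS^•(X × X)`,
  semisimplicity of every twisted Frobenius `χ(F)ʲ F` on `Hⁱ(X)`.
* §3 under `S^d(X × X)`, Tate's theorem in Milne's 1986 form simplifies in every codimension:
  `dim K·Aʳ(X) = dim H^{2r}(X)(r)₁ ⟺ K·Aʳ(X) = Ker(φ_r − 1)`, `dim K·Aʳ = dim Ker(φ_r − 1) ⟹ T^r`, and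
  (trace formula, `χ(φ) = q`, RH) `ord_{t=q^{-r}} Z(X, t) = dim Ker(φ_r − 1)`,
  `ord = dim K·Aʳ ⟺ K·Aʳ = Ker(φ_r − 1)` (rows g38-#3/#5 with their `SS^{2r}` hypothesis discharged).

What this file does NOT do: the representation-level `SS^i` (Kahn's wording «the action of `G` is
semisimple») still needs the «`φ`-stable ⟹ `Γ_k`-stable» hypothesis of gen-38 row #17 (or all classes
smooth, row g39-#3); `S^d(X × X)` itself is not proved for any `X`.  HC is not touched.

## Provenance

Lane `lit-hodgefound` (summit `HodgeConjecture`, Track 2 foundations library, Layer B: motives),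
seat `lit-hodgefound-p29` (literature-prover, generation 39, row g39-#7).
-/

universe u v

open CategoryTheory AlgebraicGeometry MonoidalCategory CartesianMonoidalCategory
open scoped TensorProduct

noncomputable section

namespace Literature.AlgebraicGeometry.Motives

open Literature.LinearAlgebra

namespace GaloisWeilCohomology

variable {k : Type u} [Field k] [Finite k] {K : Type v} [Field K] [CharZero K]
  {χ : Field.absoluteGaloisGroup k →* Kˣ} (E : GaloisWeilCohomology k K χ)
variable {d : ℕ} {X : SchemeOver k}

/-! ## §1 Th. 6.54 ⟹ without the split hypothesis -/

/-- **KAHN 2020 TH. 6.54 ⟹ / MILNE 2007 TH. 1.3, IN FULL**: if `S^d(X × X)` holds for the abstract `E`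
over a finite field (`Ker(Φ − 1) ∩ (Φ − 1)H^{2d}(X × X) = 0`, `Φ = χ(F)ᵈ F`), then the geometric
Frobenius is a SEMISIMPLE endomorphism of every `Hⁱ(X)` — no hypothesis on the characteristic
polynomials (the linear algebra is base-changed to `K̄` and semisimplicity descends, rows g39-#5/#6).
Data fed to `Literature.LinearAlgebra.isSemisimple_of_kunneth_pairing`: the perfect Poincaré pairing
`Hⁱ(X) × H^{2d−i}(X) → K`, invariant under `(F, χ(F)ᵈ F)`; the external cup product, injective on
`Hⁱ(X) ⊗ H^{2d−i}(X)` (Künneth) and equivariant; `S^d(X × X)`.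
[cite: Kahn2020, §6.14 Th. 6.54] [cite: Milne2007TateFiniteFieldsAIM, Th. 1.3]
[cite: Milne1986ValuesZetaFunctionsFiniteFields, §8 Rem. 8.6] -/
theorem isSemisimple_frobAction_of_strongTate_self_product (hX : IsSmoothProjective d X)
    (hS : LinearMap.ker (E.ρTwist (X ⊗ X) (2 * d) d (geomFrob k) - 1) ⊓
      LinearMap.range (E.ρTwist (X ⊗ X) (2 * d) d (geomFrob k) - 1) = ⊥) (i : ℕ) :
    Module.End.IsSemisimple (E.frobAction X i) := by
  by_cases hi : i ≤ 2 * d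
  swap
  · exact E.isSemisimple_frobAction_of_lt hX (by omega)
  have hj : i + (2 * d - i) = 2 * d := by omega
  haveI := E.finite_obj hX i
  haveI := E.finite_obj hX (2 * d - i)
  haveI := E.isPerfPair_cupPairing hX i (2 * d - i) hj
  refine isSemisimple_of_kunneth_pairing (E.cupPairing X d i (2 * d - i) hj) (E.frobAction X i)
    (E.ρTwist X (2 * d - i) d (geomFrob k)) (E.ρTwist (X ⊗ X) (2 * d) d (geomFrob k))
    (fun a b ↦ ?_) (E.externalCup X X hj) (fun a b ↦ ?_) (E.extTensor_injective hX hX hj) hS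
  · rw [frobAction_def]
    exact E.cupPairing_ρ_ρTwist hX hj (geomFrob k) a b
  · rw [frobAction_def, ← E.ρTwist_externalCup_right hX hX hj d (geomFrob k) a b]

/-- **Every twisted Frobenius `χ(F)ʲ F` on `Hⁱ(X)` is semisimple under `S^d(X × X)`** (a non-zero
scalar multiple of a semisimple endomorphism). [cite: Kahn2020, §6.14 Th. 6.54] [cite: Milne2007TateFiniteFieldsAIM, Th. 1.3] -/
theorem isSemisimple_ρTwist_geomFrob_of_strongTate_self_product (hX : IsSmoothProjective d X)
    (hS : LinearMap.ker (E.ρTwist (X ⊗ X) (2 * d) d (geomFrob k) - 1) ⊓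
      LinearMap.range (E.ρTwist (X ⊗ X) (2 * d) d (geomFrob k) - 1) = ⊥) (i : ℕ) (j : ℤ) :
    Module.End.IsSemisimple (E.ρTwist X i j (geomFrob k)) :=
  (E.isSemisimple_ρTwist_geomFrob_iff X i j).mpr
    (E.isSemisimple_frobAction_of_strongTate_self_product hX hS i)

/-- **Every generalized eigenspace of Frobenius on `Hⁱ(X)` is the eigenspace under `S^d(X × X)`**, for
all `i` and all `μ ∈ K` (gen-37's `maxGenEigenspace_frobAction_eq_eigenspace` without the bound
`i ≤ 2d`, now a corollary of semisimplicity). [cite: Milne2007TateFiniteFieldsAIM, Th. 1.3] -/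
theorem maxGenEigenspace_frobAction_eq_eigenspace_of_strongTate_self_product
    (hX : IsSmoothProjective d X)
    (hS : LinearMap.ker (E.ρTwist (X ⊗ X) (2 * d) d (geomFrob k) - 1) ⊓
      LinearMap.range (E.ρTwist (X ⊗ X) (2 * d) d (geomFrob k) - 1) = ⊥) (i : ℕ) (μ : K) :
    Module.End.maxGenEigenspace (E.frobAction X i) μ = Module.End.eigenspace (E.frobAction X i) μ :=
  E.maxGenEigenspace_frobAction_eq_eigenspace_of_isSemisimple X i
    (E.isSemisimple_frobAction_of_strongTate_self_product hX hS i) μ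

/-! ## §2 Th. 6.54 as an equivalence, and corollaries -/

/-- **KAHN 2020 TH. 6.54 — `S^d(X × X) ⟺ SS^i(X)` for all `i` — UNCONDITIONALLY** for the abstract
`E` over a finite field, `SS^i` at the level of the Frobenius endomorphism (Milne's «`π` acts
semisimply»; ⟸ is row g38-#3). [cite: Kahn2020, §6.14 Th. 6.54] [cite: Milne2007TateFiniteFieldsAIM, Th. 1.3] -/
theorem strongTate_self_product_iff_forall_isSemisimple_frobAction (hX : IsSmoothProjective d X) :
    LinearMap.ker (E.ρTwist (X ⊗ X) (2 * d) d (geomFrob k) - 1) ⊓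
        LinearMap.range (E.ρTwist (X ⊗ X) (2 * d) d (geomFrob k) - 1) = ⊥ ↔
      ∀ i, Module.End.IsSemisimple (E.frobAction X i) :=
  ⟨fun hS i ↦ E.isSemisimple_frobAction_of_strongTate_self_product hX hS i,
    E.ker_inf_range_eq_bot_self_product_of_isSemisimple_frobAction hX⟩

/-- **`S^d(X × X) ⟹ S` for EVERY twisted Frobenius on `H^*(X × X)`** (no split hypothesis).
[cite: Kahn2020, §6.14 Th. 6.54] -/
theorem ker_inf_range_eq_bot_self_product_all_of_strongTate (hX : IsSmoothProjective d X)
    (hS : LinearMap.ker (E.ρTwist (X ⊗ X) (2 * d) d (geomFrob k) - 1) ⊓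
      LinearMap.range (E.ρTwist (X ⊗ X) (2 * d) d (geomFrob k) - 1) = ⊥) (e : ℕ) (j : ℤ) :
    LinearMap.ker (E.ρTwist (X ⊗ X) e j (geomFrob k) - 1) ⊓
      LinearMap.range (E.ρTwist (X ⊗ X) e j (geomFrob k) - 1) = ⊥ :=
  have hXs := E.isSemisimple_frobAction_of_strongTate_self_product hX hS
  E.ker_inf_range_eq_bot_tensor_of_isSemisimple_frobAction hX hX hXs hXs e j

/-- **`S^d(X × X) ⟹ S` for every twisted Frobenius on `H^*(X)`** (no split hypothesis; for the twists
`(2r, r)`, `r ≤ d`, gen-37's `ker_inf_range_eq_bot_of_self_product`). [cite: Kahn2020, §6.14 Th. 6.54]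
[cite: Milne2007TateFiniteFieldsAIM, Th. 1.3] -/
theorem ker_inf_range_eq_bot_all_of_strongTate_self_product (hX : IsSmoothProjective d X)
    (hS : LinearMap.ker (E.ρTwist (X ⊗ X) (2 * d) d (geomFrob k) - 1) ⊓
      LinearMap.range (E.ρTwist (X ⊗ X) (2 * d) d (geomFrob k) - 1) = ⊥) (i : ℕ) (j : ℤ) :
    LinearMap.ker (E.ρTwist X i j (geomFrob k) - 1) ⊓
      LinearMap.range (E.ρTwist X i j (geomFrob k) - 1) = ⊥ :=
  E.ker_inf_range_eq_bot_twist_of_isSemisimple_frobAction X i j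
    (E.isSemisimple_frobAction_of_strongTate_self_product hX hS i)

/-- **`S^d(X × X) ⟹ SS^•(X × X)`** (no split hypothesis): Frobenius is semisimple on all of
`H^*(X × X)` (Künneth, row g38-#2). [cite: Kahn2020, §6.14 Th. 6.54] -/
theorem isSemisimple_frobAction_self_product_of_strongTate (hX : IsSmoothProjective d X)
    (hS : LinearMap.ker (E.ρTwist (X ⊗ X) (2 * d) d (geomFrob k) - 1) ⊓
      LinearMap.range (E.ρTwist (X ⊗ X) (2 * d) d (geomFrob k) - 1) = ⊥) (e : ℕ) :
    Module.End.IsSemisimple (E.frobAction (X ⊗ X) e) :=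
  have hXs := E.isSemisimple_frobAction_of_strongTate_self_product hX hS
  E.isSemisimple_frobAction_tensor_of_forall hX hX hXs hXs e

/-- **`S^d(X × X) ⟺ S^{2d}((X × X) × (X × X))`**: the condition is stable under squaring the variety
(apply Th. 6.54 to `X × X`, of dimension `2d`). [cite: Kahn2020, §6.14 Th. 6.54] -/
theorem strongTate_self_product_iff_strongTate_self_product_sq (hX : IsSmoothProjective d X) :
    LinearMap.ker (E.ρTwist (X ⊗ X) (2 * d) d (geomFrob k) - 1) ⊓
        LinearMap.range (E.ρTwist (X ⊗ X) (2 * d) d (geomFrob k) - 1) = ⊥ ↔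
      LinearMap.ker (E.ρTwist ((X ⊗ X) ⊗ (X ⊗ X)) (2 * (2 * d)) ((2 * d : ℕ) : ℤ) (geomFrob k) - 1) ⊓
        LinearMap.range
          (E.ρTwist ((X ⊗ X) ⊗ (X ⊗ X)) (2 * (2 * d)) ((2 * d : ℕ) : ℤ) (geomFrob k) - 1) = ⊥ := by
  have hXX : IsSmoothProjective (2 * d) (X ⊗ X) := by
    have h := IsSmoothProjective.tensor_holds hX hX
    rwa [show d + d = 2 * d by omega] at h
  rw [E.strongTate_self_product_iff_forall_isSemisimple_frobAction hX,
    E.strongTate_self_product_iff_forall_isSemisimple_frobAction hXX]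
  exact ⟨fun h e ↦ E.isSemisimple_frobAction_tensor_of_forall hX hX h h e,
    fun h i ↦ E.isSemisimple_frobAction_of_tensor_left hX hX (h i)⟩

/-! ## §3 Tate's theorem under `S^d(X × X)` -/

/-- **Milne 1986 Prop. 8.2 under `S^d(X × X)`**, in every codimension `r`:
`dim_K K·Aʳ(X) = dim H^{2r}(X)(r)₁ ⟺ K·Aʳ(X) = Ker(φ_r − 1)` (the `SS` conjunct of «`T′ ∧ SS`» is
automatic). [cite: Milne1986ValuesZetaFunctionsFiniteFields, §8 Prop. 8.2] [cite: Kahn2020, §6.14 Th. 6.53 and Th. 6.54] -/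
theorem finrank_algebraicClasses_eq_iff_of_strongTate_self_product (hX : IsSmoothProjective d X)
    (hS : LinearMap.ker (E.ρTwist (X ⊗ X) (2 * d) d (geomFrob k) - 1) ⊓
      LinearMap.range (E.ρTwist (X ⊗ X) (2 * d) d (geomFrob k) - 1) = ⊥) (r : ℕ) :
    Module.finrank K (E.algebraicClasses X r) =
        Module.finrank K (Module.End.maxGenEigenspace (E.ρTwist X (2 * r) r (geomFrob k)) 1) ↔
      E.algebraicClasses X r = LinearMap.ker (E.ρTwist X (2 * r) r (geomFrob k) - 1) :=
  E.finrank_algebraicClasses_eq_iff_of_isSemisimple_frobAction hX r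
    (E.isSemisimple_frobAction_of_strongTate_self_product hX hS (2 * r))

/-- **`S^d(X × X)` and `dim K·Aʳ(X) = dim Ker(φ_r − 1)` ⟹ `T^r(X)`** (Tate's (b) ⟹ (a) without the
separate semisimplicity hypothesis). [cite: Milne1986ValuesZetaFunctionsFiniteFields, §8 Prop. 8.2]
[cite: Tate1994, §2 Th. 2.9 (a) ⟺ (b)] -/
theorem tateConjectureFor_of_finrank_eq_of_strongTate_self_product (hX : IsSmoothProjective d X)
    (hS : LinearMap.ker (E.ρTwist (X ⊗ X) (2 * d) d (geomFrob k) - 1) ⊓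
      LinearMap.range (E.ρTwist (X ⊗ X) (2 * d) d (geomFrob k) - 1) = ⊥) (r : ℕ)
    (hT : Module.finrank K (E.algebraicClasses X r) =
      Module.finrank K (LinearMap.ker (E.ρTwist X (2 * r) r (geomFrob k) - 1))) :
    E.TateConjectureFor X r :=
  E.tateConjectureFor_of_finrank_eq_of_isSemisimple_frobAction hX r
    (E.isSemisimple_frobAction_of_strongTate_self_product hX hS (2 * r)) hT

/-- **`ord_{t = q^{-r}} Z(X, t) = dim Ker(φ_r − 1)` under `S^d(X × X)`** (trace formula, `χ(arith.
Frobenius) = q`, Riemann hypothesis for `X`; `r ≤ d`): the pole order is attained by the Frobenius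
invariants, `SS^{2r}(X)` being automatic (row g38-#5 with its hypothesis discharged).
[cite: Tate1994, §2 Th. 2.9] [cite: Kahn2020, §6.14 Th. 6.53 and Th. 6.54] -/
theorem hasPoleOfOrderAt_zetaSeries_finrank_ker_of_strongTate_self_product
    (hE : E.HasLefschetzTraceFormula) (hχ : ((χ (arithFrob k) : Kˣ) : K) = Nat.card k)
    (hX : IsSmoothProjective d X) (hRH : E.WeilRiemannHypothesisFor X d)
    (hS : LinearMap.ker (E.ρTwist (X ⊗ X) (2 * d) d (geomFrob k) - 1) ⊓
      LinearMap.range (E.ρTwist (X ⊗ X) (2 * d) d (geomFrob k) - 1) = ⊥) {r : ℕ} (hr : r ≤ d) :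
    Kahn2003.HasPoleOfOrderAt (zetaSeries X) (((Nat.card k : ℚ) ^ r)⁻¹)
      (Module.finrank K (LinearMap.ker (E.ρTwist X (2 * r) r (geomFrob k) - 1))) :=
  E.hasPoleOfOrderAt_zetaSeries_finrank_ker_of_isSemisimple_frobAction hE hχ hX hRH hr
    (E.isSemisimple_frobAction_of_strongTate_self_product hX hS (2 * r))

/-- **`ord_{t = q^{-r}} Z(X, t) = dim K·Aʳ(X) ⟺ K·Aʳ(X) = Ker(φ_r − 1)` under `S^d(X × X)`** (Tate's
(c) ⟺ (a) in the finite-field form; trace formula, `χ(arith. Frobenius) = q`, RH; `r ≤ d`).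
[cite: Tate1994, §2 Th. 2.9 (a) ⟺ (c)] [cite: Kahn2020, §6.14 Th. 6.53 and Th. 6.54] -/
theorem hasPoleOfOrderAt_zetaSeries_finrank_algebraicClasses_iff_of_strongTate_self_product
    (hE : E.HasLefschetzTraceFormula) (hχ : ((χ (arithFrob k) : Kˣ) : K) = Nat.card k)
    (hX : IsSmoothProjective d X) (hRH : E.WeilRiemannHypothesisFor X d)
    (hS : LinearMap.ker (E.ρTwist (X ⊗ X) (2 * d) d (geomFrob k) - 1) ⊓
      LinearMap.range (E.ρTwist (X ⊗ X) (2 * d) d (geomFrob k) - 1) = ⊥) {r : ℕ} (hr : r ≤ d) :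
    Kahn2003.HasPoleOfOrderAt (zetaSeries X) (((Nat.card k : ℚ) ^ r)⁻¹)
        (Module.finrank K (E.algebraicClasses X r)) ↔
      E.algebraicClasses X r = LinearMap.ker (E.ρTwist X (2 * r) r (geomFrob k) - 1) :=
  E.hasPoleOfOrderAt_zetaSeries_finrank_algebraicClasses_iff_of_isSemisimple_frobAction hE hχ hX hRH
    hr (E.isSemisimple_frobAction_of_strongTate_self_product hX hS (2 * r))

end GaloisWeilCohomology

end Literature.AlgebraicGeometry.Motives

end
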